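import Mathlib
import Summits.CriticalPhenomena.SAWScalingLimit.Theorems.SAWDefectDecoherenceObservableToSLERGateDefs
import Summits.CriticalPhenomena.SAWScalingLimit.Theorems.ObservableToSLE.Negative.Identification
import Literature.Probability.RandomPlanarGeometry.HexSAWLattice

/-!
# Gate transfer, lattice 1: first exits and first good gates; geometry of the level hexagons

Support file for the stub `stub_gateTransfer` (the gate transfer
`GateDecomposition → RenewalAccumulation → CarvedToSLE → HexTight → FullIdentification`) of the
line `bridge-gate-renewal` for the crux
`Summit.CriticalPhenomena.SAWScalingLimit.Theses.SAWDefectDecoherence.ObservableToSLER`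
(item `stmt-CriticalPhenomena-14005`).

* combinatorics of `IsFirstExit` / `IsFirstGoodGate` over the vocabulary of
  `SAWDefectDecoherenceObservableToSLERGateDefs`: indices, membership, uniqueness of first-exit
  data at a level and of first good gates, existence of a first good gate under `GoodRenewalAt`;
* the skew coordinates `skewCoord` (linear, continuous, `2`-Lipschitz, control the norm), the
  skew coordinates of a face centre (strictly between the rows, never integers), the open
  hexagon `openHex` (open, convex, inside the interior of `contHex`), closedness and convexity
  of `contHex`.  Elementary; tagged [folklore].
-/

noncomputable section

open scoped BigOperators Topology NNReal ENNReal Classical BoundedContinuousFunction unitInterval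
open Filter Set MeasureTheory Metric

namespace Summit.CriticalPhenomena.SAWScalingLimit.Theorems.ObservableToSLER.BridgeGate

open Literature.Probability.LatticeModels (HexVertex hexGraph hexCenter triZeta Site)
open Literature.Probability.RandomPlanarGeometry
open Literature.Probability.RandomPlanarGeometry.SAW

section Combinatorics

variable {Ω : Set ℂ} {δ r R ρ : ℝ} {c : HexVertex} {l : List HexVertex}

/-- In a first exit the exit index is inside the list and the exit vertex is the entry there. -/
theorem IsFirstExit.getElem?_eq {n m : ℕ} {p q : HexVertex} (h : IsFirstExit c n l m p q) :
    l[m]? = some q := by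
  rw [← List.head?_drop]; exact h.2.1

/-- In a first exit the exit index is positive. -/
theorem IsFirstExit.pos {n m : ℕ} {p q : HexVertex} (h : IsFirstExit c n l m p q) : 0 < m := by
  rcases Nat.eq_zero_or_pos m with rfl | hm
  · exact absurd h.1 (by simp)
  · exact hm

/-- In a first exit the exit index is less than the length of the list. -/
theorem IsFirstExit.lt_length {n m : ℕ} {p q : HexVertex} (h : IsFirstExit c n l m p q) :
    m < l.length := by
  have := h.getElem?_eq
  rw [List.getElem?_eq_some_iff] at this
  exact this.1

/-- In a first exit the last inside vertex is the entry at index `m - 1`. -/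
theorem IsFirstExit.getElem?_pred_eq {n m : ℕ} {p q : HexVertex} (h : IsFirstExit c n l m p q) :
    l[m - 1]? = some p := by
  have hm := h.pos
  have hml := h.lt_length
  have h1 := h.1
  rw [List.getLast?_eq_getElem?, List.length_take, min_eq_left hml.le, List.getElem?_take] at h1
  simpa [Nat.sub_lt hm one_pos] using h1

/-- In a first exit, `p` is one of the first `m` entries. -/
theorem IsFirstExit.fst_mem_take {n m : ℕ} {p q : HexVertex} (h : IsFirstExit c n l m p q) :
    p ∈ l.take m :=
  List.mem_of_getElem? (by
    rw [List.getElem?_take, if_pos (Nat.sub_lt h.pos one_pos)]; exact h.getElem?_pred_eq)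

/-- In a first exit, `p` is an entry of the list. -/
theorem IsFirstExit.fst_mem {n m : ℕ} {p q : HexVertex} (h : IsFirstExit c n l m p q) : p ∈ l :=
  List.mem_of_mem_take h.fst_mem_take

/-- In a first exit, `q` is one of the entries from index `m` on. -/
theorem IsFirstExit.snd_mem_drop {n m : ℕ} {p q : HexVertex} (h : IsFirstExit c n l m p q) :
    q ∈ l.drop m :=
  List.mem_iff_getElem?.2 ⟨0, by rw [List.getElem?_drop, Nat.add_zero]; exact h.getElem?_eq⟩

/-- In a first exit, `q` is an entry of the list. -/
theorem IsFirstExit.snd_mem {n m : ℕ} {p q : HexVertex} (h : IsFirstExit c n l m p q) : q ∈ l :=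
  List.mem_of_mem_drop h.snd_mem_drop

/-- In a first exit, the last entry of the list comes at or after the exit. -/
theorem IsFirstExit.getLast_mem_drop {n m : ℕ} {p q : HexVertex} (h : IsFirstExit c n l m p q)
    (hl : l ≠ []) : l.getLast hl ∈ l.drop m := by
  rw [List.mem_iff_getElem?]
  refine ⟨l.length - 1 - m, ?_⟩
  have := h.lt_length
  rw [List.getElem?_drop, show m + (l.length - 1 - m) = l.length - 1 by omega,
    List.getLast_eq_getElem, List.getElem?_eq_getElem]

/-- **First-exit data at a given level are unique.** -/
theorem IsFirstExit.unique {n m m' : ℕ} {p q p' q' : HexVertex} (h : IsFirstExit c n l m p q)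
    (h' : IsFirstExit c n l m' p' q') : m = m' ∧ p = p' ∧ q = q' := by
  -- the exit indices agree: a smaller exit index would put an outside vertex inside
  have key : ∀ {m₁ m₂ : ℕ} {p₁ q₁ p₂ q₂ : HexVertex}, IsFirstExit c n l m₁ p₁ q₁ →
      IsFirstExit c n l m₂ p₂ q₂ → ¬ m₁ < m₂ := by
    intro m₁ m₂ p₁ q₁ p₂ q₂ h₁ h₂ hlt
    have hq : l[m₁]? = some q₁ := h₁.getElem?_eq
    rw [List.getElem?_eq_some_iff] at hq
    obtain ⟨hm₁, rfl⟩ := hq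
    apply h₁.2.2.2
    apply h₂.2.2.1
    rw [List.mem_take_iff_getElem]
    exact ⟨m₁, by rw [Nat.lt_min]; exact ⟨hlt, hm₁⟩, rfl⟩
  have hm : m = m' := by
    rcases lt_trichotomy m m' with hlt | heq | hgt
    · exact absurd hlt (key h h')
    · exact heq
    · exact absurd hgt (key h' h)
  subst hm
  refine ⟨rfl, ?_, ?_⟩
  · have := h.getElem?_pred_eq.symm.trans h'.getElem?_pred_eq
    simpa using this
  · have := h.getElem?_eq.symm.trans h'.getElem?_eq
    simpa using this

/-- **First good gates are unique.** -/
theorem IsFirstGoodGate.unique {n m n' m' : ℕ} {p q p' q' : HexVertex}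
    (h : IsFirstGoodGate Ω δ r R ρ c l n m p q) (h' : IsFirstGoodGate Ω δ r R ρ c l n' m' p' q') :
    n = n' ∧ m = m' ∧ p = p' ∧ q = q' := by
  have hn : n = n' := le_antisymm (h.2 _ _ _ _ h'.1) (h'.2 _ _ _ _ h.1)
  subst hn
  exact ⟨rfl, h.1.2.2.1.unique h'.1.2.2.1⟩

/-- A good renewal has a FIRST good gate (minimal good level). -/
theorem GoodRenewalAt.exists_isFirstGoodGate (h : GoodRenewalAt Ω δ r R ρ c l) :
    ∃ (n m : ℕ) (p q : HexVertex), IsFirstGoodGate Ω δ r R ρ c l n m p q := by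
  classical
  have hex : ∃ n, ∃ (m : ℕ) (p q : HexVertex), IsGoodGate Ω δ r R ρ c l n m p q := h
  obtain ⟨m, p, q, hg⟩ := Nat.find_spec hex
  exact ⟨Nat.find hex, m, p, q, hg, fun n' m' p' q' h' => Nat.find_min' hex ⟨m', p', q', h'⟩⟩

/-- A first good gate is in particular a good renewal. -/
theorem IsFirstGoodGate.goodRenewalAt {n m : ℕ} {p q : HexVertex}
    (h : IsFirstGoodGate Ω δ r R ρ c l n m p q) : GoodRenewalAt Ω δ r R ρ c l :=
  ⟨n, m, p, q, h.1⟩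

end Combinatorics

end Summit.CriticalPhenomena.SAWScalingLimit.Theorems.ObservableToSLER.BridgeGate

namespace Summit.CriticalPhenomena.SAWScalingLimit.Theorems.ObservableToSLER.BridgeGate

open Literature.Probability.LatticeModels (HexVertex hexGraph hexCenter triZeta Site polyline)
open Literature.Probability.RandomPlanarGeometry
open Literature.Probability.RandomPlanarGeometry.SAW
open Summit.CriticalPhenomena.SAWScalingLimit.Theorems.ObservableToSLE.Negative (hexCenter_re_im)

section Hexagon

variable {δ : ℝ} {c : HexVertex} {n : ℕ}

/-- `√3` facts. -/
theorem sqrt_three_pos : (0 : ℝ) < Real.sqrt 3 := Real.sqrt_pos.2 (by norm_num)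

/-- `√3 < 2`. -/
theorem sqrt_three_lt_two : Real.sqrt 3 < 2 := by
  rw [show (2 : ℝ) = Real.sqrt 4 by rw [show (4:ℝ) = 2 ^ 2 by norm_num, Real.sqrt_sq (by norm_num)]]
  exact Real.sqrt_lt_sqrt (by norm_num) (by norm_num)

/-- `1 < √3`. -/
theorem one_lt_sqrt_three : 1 < Real.sqrt 3 := by
  rw [show (1 : ℝ) = Real.sqrt 1 by simp]
  exact Real.sqrt_lt_sqrt (by norm_num) (by norm_num)

/-- The skew coordinates in terms of real and imaginary parts. -/
theorem skewCoord_eq (i : Fin 3) (z : ℂ) :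
    skewCoord i z = if i = 0 then 2 * z.im / Real.sqrt 3 else
      if i = 1 then z.re - z.im / Real.sqrt 3 else z.re + z.im / Real.sqrt 3 := by
  fin_cases i <;> simp [skewCoord]

/-- The skew coordinates are real-linear. -/
theorem isLinearMap_skewCoord_div (i : Fin 3) (δ : ℝ) :
    IsLinearMap ℝ fun z : ℂ => skewCoord i (z / δ) := by
  constructor
  · intro z w
    simp only [skewCoord_eq, add_div, Complex.add_re, Complex.add_im]
    split_ifs <;> ring
  · intro a z
    simp only [skewCoord_eq, Complex.real_smul, mul_div_assoc, Complex.mul_re, Complex.mul_im,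
      Complex.ofReal_re, Complex.ofReal_im, zero_mul, sub_zero, add_zero, smul_eq_mul]
    split_ifs <;> ring

/-- The skew coordinates are continuous. -/
theorem continuous_skewCoord_div (i : Fin 3) (δ : ℝ) :
    Continuous fun z : ℂ => skewCoord i (z / δ) := by
  simp only [skewCoord_eq]
  split_ifs <;> fun_prop

/-- The skew coordinates commute with real rescaling. -/
theorem skewCoord_mul_div (i : Fin 3) (hδ : δ ≠ 0) (w : ℂ) :
    skewCoord i ((δ : ℂ) * w / δ) = skewCoord i w := by
  rw [mul_div_assoc, mul_div_cancel₀ _ (Complex.ofReal_ne_zero.2 hδ)]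

/-- The skew coordinates of a difference. -/
theorem skewCoord_sub (i : Fin 3) (z w : ℂ) :
    skewCoord i (z - w) = skewCoord i z - skewCoord i w := by
  simp only [skewCoord_eq, Complex.sub_re, Complex.sub_im]
  split_ifs <;> ring

/-- The skew coordinates are `2`-Lipschitz seminorms: `|skewCoord i w| ≤ 2 ‖w‖`. -/
theorem abs_skewCoord_le (i : Fin 3) (w : ℂ) : |skewCoord i w| ≤ 2 * ‖w‖ := by
  have hre := Complex.abs_re_le_norm w
  have him := Complex.abs_im_le_norm w
  have h3 := one_lt_sqrt_three
  have h3' := sqrt_three_pos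
  have him' : |w.im / Real.sqrt 3| ≤ ‖w‖ := by
    rw [abs_div, abs_of_pos h3', div_le_iff₀ h3']
    nlinarith [norm_nonneg w]
  rw [skewCoord_eq]
  split_ifs
  · rw [abs_div, abs_mul, abs_of_pos h3', abs_two, div_le_iff₀ h3']
    nlinarith [norm_nonneg w]
  · calc |w.re - w.im / Real.sqrt 3| ≤ |w.re| + |w.im / Real.sqrt 3| := abs_sub _ _
      _ ≤ ‖w‖ + ‖w‖ := add_le_add hre him'
      _ = 2 * ‖w‖ := by ring
  · calc |w.re + w.im / Real.sqrt 3| ≤ |w.re| + |w.im / Real.sqrt 3| := abs_add_le _ _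
      _ ≤ ‖w‖ + ‖w‖ := add_le_add hre him'
      _ = 2 * ‖w‖ := by ring

/-- Conversely the norm is controlled by the first two skew coordinates:
`‖w‖ ≤ |skewCoord 1 w| + 2 |skewCoord 0 w|`. -/
theorem norm_le_skewCoord (w : ℂ) : ‖w‖ ≤ |skewCoord 1 w| + 2 * |skewCoord 0 w| := by
  have h3' := sqrt_three_pos
  have h0 : skewCoord 0 w = 2 * w.im / Real.sqrt 3 := by simp [skewCoord_eq]
  have h1 : skewCoord 1 w = w.re - w.im / Real.sqrt 3 := by simp [skewCoord_eq]
  have him : w.im = Real.sqrt 3 / 2 * skewCoord 0 w := by rw [h0]; field_simp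
  have hre : w.re = skewCoord 1 w + skewCoord 0 w / 2 := by rw [h1, h0]; field_simp; ring
  calc ‖w‖ ≤ |w.re| + |w.im| := Complex.norm_le_abs_re_add_abs_im w
    _ = |skewCoord 1 w + skewCoord 0 w / 2| + |Real.sqrt 3 / 2 * skewCoord 0 w| := by
        rw [← hre, ← him]
    _ ≤ |skewCoord 1 w| + |skewCoord 0 w / 2| + |Real.sqrt 3 / 2 * skewCoord 0 w| := by
        gcongr; exact abs_add_le _ _
    _ = |skewCoord 1 w| + (1 / 2 + Real.sqrt 3 / 2) * |skewCoord 0 w| := by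
        rw [abs_div, abs_mul, abs_of_pos (by positivity : (0:ℝ) < Real.sqrt 3 / 2), abs_two]; ring
    _ ≤ |skewCoord 1 w| + 2 * |skewCoord 0 w| := by
        gcongr
        linarith [sqrt_three_lt_two]

/-- **Skew coordinates of a face centre**: strictly between the rows, with margin `1/3`. -/
theorem skewCoord_hexCenter_mem (i : Fin 3) (v : HexVertex) :
    skewCoord i (hexCenter v) ∈ Icc ((rowCoord i v : ℝ) + 1 / 3) ((rowCoord i v : ℝ) + 2 / 3) := by
  obtain ⟨x, k⟩ := v
  obtain ⟨hre, him⟩ := hexCenter_re_im x k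
  have h3 : Real.sqrt 3 ≠ 0 := sqrt_three_pos.ne'
  have hk0 : (0 : ℝ) ≤ (k : ℕ) := Nat.cast_nonneg _
  have hk1 : ((k : ℕ) : ℝ) ≤ 1 := by exact_mod_cast Nat.lt_succ_iff.1 k.2
  have e0 : skewCoord 0 (hexCenter (x, k)) = x 1 + ((k : ℕ) + 1) / 3 := by
    rw [skewCoord_eq]; simp only [Fin.isValue, ↓reduceIte]; rw [him]; field_simp
  have e1 : skewCoord 1 (hexCenter (x, k)) = x 0 + ((k : ℕ) + 1) / 3 := by
    rw [skewCoord_eq]; simp only [Fin.isValue, one_ne_zero, ↓reduceIte]; rw [hre, him]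
    field_simp; ring
  have e2 : skewCoord 2 (hexCenter (x, k)) = x 0 + x 1 + 2 * ((k : ℕ) + 1) / 3 := by
    rw [skewCoord_eq]; simp only [Fin.isValue, Fin.reduceEq, ↓reduceIte]; rw [hre, him]
    field_simp; ring
  fin_cases i
  · simp only [Fin.zero_eta, Fin.isValue, e0, rowCoord, ↓reduceIte, mem_Icc]
    constructor <;> linarith
  · simp only [Fin.mk_one, Fin.isValue, e1, rowCoord, one_ne_zero, ↓reduceIte, mem_Icc]
    constructor <;> linarith
  · simp only [Fin.reduceFinMk, Fin.isValue, e2, rowCoord, Fin.reduceEq, ↓reduceIte, mem_Icc]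
    push_cast
    constructor <;> linarith

/-- A skew coordinate of a face centre is never an integer. -/
theorem skewCoord_hexCenter_ne_int (i : Fin 3) (v : HexVertex) (k : ℤ) :
    skewCoord i (hexCenter v) ≠ k := by
  intro h
  obtain ⟨h1, h2⟩ := skewCoord_hexCenter_mem i v
  rw [h] at h1 h2
  have h1' : rowCoord i v < k := by
    have : (rowCoord i v : ℝ) < k := by linarith
    exact_mod_cast this
  have h2' : k < rowCoord i v + 1 := by
    have : (k : ℝ) < rowCoord i v + 1 := by linarith
    exact_mod_cast this
  omega

/-- The OPEN continuum hexagon: strict inequalities in `contHex`. -/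
def openHex (δ : ℝ) (c : HexVertex) (n : ℕ) : Set ℂ :=
  {z | ∀ i : Fin 3, (rowCoord i c : ℝ) - n < skewCoord i (z / δ) ∧
    skewCoord i (z / δ) < (rowCoord i c : ℝ) + n + 1}

/-- The open hexagon is open. -/
theorem isOpen_openHex (δ : ℝ) (c : HexVertex) (n : ℕ) : IsOpen (openHex δ c n) := by
  have : openHex δ c n = ⋂ i : Fin 3, ({z : ℂ | (rowCoord i c : ℝ) - n < skewCoord i (z / δ)} ∩
      {z : ℂ | skewCoord i (z / δ) < (rowCoord i c : ℝ) + n + 1}) := by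
    ext z; simp [openHex]
  rw [this]
  exact isOpen_iInter_of_finite fun i =>
    (isOpen_lt continuous_const (continuous_skewCoord_div i δ)).inter
      (isOpen_lt (continuous_skewCoord_div i δ) continuous_const)

/-- The closed hexagon is closed. -/
theorem isClosed_contHex (δ : ℝ) (c : HexVertex) (n : ℕ) : IsClosed (contHex δ c n) := by
  have : contHex δ c n = ⋂ i : Fin 3, ({z : ℂ | (rowCoord i c : ℝ) - n ≤ skewCoord i (z / δ)} ∩
      {z : ℂ | skewCoord i (z / δ) ≤ (rowCoord i c : ℝ) + n + 1}) := by
    ext z; simp [contHex]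
  rw [this]
  exact isClosed_iInter fun i =>
    (isClosed_le continuous_const (continuous_skewCoord_div i δ)).inter
      (isClosed_le (continuous_skewCoord_div i δ) continuous_const)

/-- The open hexagon is convex. -/
theorem convex_openHex (δ : ℝ) (c : HexVertex) (n : ℕ) : Convex ℝ (openHex δ c n) := by
  have : openHex δ c n = ⋂ i : Fin 3, ({z : ℂ | (rowCoord i c : ℝ) - n < skewCoord i (z / δ)} ∩
      {z : ℂ | skewCoord i (z / δ) < (rowCoord i c : ℝ) + n + 1}) := by
    ext z; simp [openHex]
  rw [this]
  exact convex_iInter fun i => (convex_halfSpace_gt (isLinearMap_skewCoord_div i δ) _).inter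
    (convex_halfSpace_lt (isLinearMap_skewCoord_div i δ) _)

/-- The closed hexagon is convex. -/
theorem convex_contHex (δ : ℝ) (c : HexVertex) (n : ℕ) : Convex ℝ (contHex δ c n) := by
  have : contHex δ c n = ⋂ i : Fin 3, ({z : ℂ | (rowCoord i c : ℝ) - n ≤ skewCoord i (z / δ)} ∩
      {z : ℂ | skewCoord i (z / δ) ≤ (rowCoord i c : ℝ) + n + 1}) := by
    ext z; simp [contHex]
  rw [this]
  exact convex_iInter fun i => (convex_halfSpace_ge (isLinearMap_skewCoord_div i δ) _).inter
    (convex_halfSpace_le (isLinearMap_skewCoord_div i δ) _)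

/-- The open hexagon lies in the closed one. -/
theorem openHex_subset_contHex : openHex δ c n ⊆ contHex δ c n :=
  fun _ hz i => ⟨(hz i).1.le, (hz i).2.le⟩

/-- The open hexagon lies in the interior of the closed one. -/
theorem openHex_subset_interior : openHex δ c n ⊆ interior (contHex δ c n) :=
  interior_maximal openHex_subset_contHex (isOpen_openHex δ c n)

/-- The open hexagon misses the frontier of the closed one. -/
theorem not_mem_frontier_of_mem_openHex {z : ℂ} (hz : z ∈ openHex δ c n) :
    z ∉ frontier (contHex δ c n) := fun h => h.2 (openHex_subset_interior hz)

end Hexagon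

end Summit.CriticalPhenomena.SAWScalingLimit.Theorems.ObservableToSLER.BridgeGate

namespace Summit.CriticalPhenomena.SAWScalingLimit.Theorems.ObservableToSLER.BridgeGate

open Literature.Probability.LatticeModels (HexVertex hexGraph hexCenter triZeta Site)
open Literature.Probability.RandomPlanarGeometry
open Literature.Probability.RandomPlanarGeometry.SAW

/-- **Registered sub-goal `stub_firstGoodGateUnique`** (first good gates are unique; self-contained form of `IsFirstGoodGate.unique`). -/
theorem stub_firstGoodGateUnique : ∀ (Ω : Set ℂ) (δ r R ρ : ℝ) (c : HexVertex) (l : List HexVertex) (n m n' m' : ℕ) (p q p' q' : HexVertex), IsFirstGoodGate Ω δ r R ρ c l n m p q → IsFirstGoodGate Ω δ r R ρ c l n' m' p' q' → n = n' ∧ m = m' ∧ p = p' ∧ q = q' :=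
  fun _ _ _ _ _ _ _ _ _ _ _ _ _ _ _ h h' => h.unique h'

end Summit.CriticalPhenomena.SAWScalingLimit.Theorems.ObservableToSLER.BridgeGate

end
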